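import Mathlib
import Summits.Ventures.HodgeRepro.Tier4.Common.CompactUnimodular
import Summits.Ventures.HodgeRepro.Tier4.Common.KTypeProjector

/-!
# Tier4/Common/TestProjector — the `(C, χ)`-projection of a TEST FUNCTION: `e ⋆ f`, `f ⋆ e`, `e ⋆ f ⋆ e` are test
functions, bi-equivariant, and `R(e ⋆ f ⋆ e) = e ∘ R(f) ∘ e`

Blind re-derivation cell `pub-hodge-repro`, Tier 4 «prove the step» (README §9–§10), seat t4-typer-2 (gen 3).
Target tree path `lean/Summits/Ventures/HodgeRepro/Tier4/Common/TestProjector.lean`.  Mathlib +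
`Common.{CompactUnimodular, KTypeProjector}`; no literature.  Generic over a topological group `G` (consumers:
`GA W` with `rightRegular`, L1's `RTF.Setting.R` — definitionally the displayed integrals).

WHY (plan-4 S13921, CUT C-L4-PROJ, the analytic half): the re-typed L4 wall needs a test function `f₁` that is
BI-`(τ′,K)`-equivariant (crit-1 S13839: «the identity needs RIGHT-equivariance … the wall's displays are
LEFT-equivariance») so that `R(f̄₁)` maps into the type space and kills its orthogonal complement.  With the compact
subgroup `C`, its Haar probability `ν` and a unit character `χ`:
* `lProj C ν χ f y := ∫_C χ(κ) f(κ y) dν` (= `e ⋆ f`), `rProj C ν χ f y := ∫_C χ(κ) f(y κ) dν` (= `f ⋆ e`),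
  `biProj := lProj ∘ rProj` (= `e ⋆ f ⋆ e`);
* equivariance: `rProj_apply_mul` (`f ⋆ e (y κ) = conj χ(κ) · f ⋆ e (y)`), `lProj_apply_inv_mul`
  (`e ⋆ f (κ⁻¹ y) = χ(κ) · e ⋆ f (y)`), `lProj_apply_mul`, and for the composite **`biProj_apply_mul`** (right) and
  **`biProj_apply_inv_mul`** (left) — the bi-equivariance, as THEOREMS;
* test functions: `continuous_lProj`, `hasCompactSupport_lProj` (support inside `C⁻¹ · supp f`), `continuous_rProj`,
  `hasCompactSupport_rProj`, **`isTestFn_biProj`** (continuous with compact support);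
* THE OPERATOR IDENTITIES (Fubini on `μ.prod ν`, the substitutions `y ↦ κ⁻¹ y` / `y ↦ y κ⁻¹`, inversion invariance
  of `ν`): **`integral_lProj_mul_eq`** — `R(e ⋆ f) φ = e_{C,χ}(R(f) φ)`; **`integral_rProj_mul_eq`** —
  `R(f ⋆ e) φ = R(f)(e_{C,χ} φ)`; **`integral_biProj_mul_eq`** — `R(e ⋆ f ⋆ e) φ = e_{C,χ}(R(f)(e_{C,χ} φ))`;
* the `hvan` shape for `f₁ := e ⋆ f ⋆ e`: **`integral_biProj_mul_eq_zero_of_orthogonal`** — `⟨ψ, e ψ⟩_D = 0 ⇒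
  R(e ⋆ f ⋆ e) ψ = 0` (from KTypeProjectorAdjoint's `integral_mul_eq_zero_of_orthogonal` and `biProj_apply_mul`),
  imported by name in `Tier4/Common/TestProjectorVanishing.lean` (kept separate: the 400-line rule).

One `(C, χ)` at a time; the composite over the places and the level is `KTypeProjectorCompose` + `PlaceCommute`.
For `R(f̄₁)` with the CONJUGATE test function: `conj ∘ (e ⋆ f ⋆ e) = ē ⋆ f̄ ⋆ ē` (`cj_lProj`, `cj_rProj`, `cj_biProj`).

Nothing here says anything about the status of the Hodge conjecture for CM abelian varieties, which is NOT proved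
(HC_CM is NOT proved by anyone in this repository).
-/

set_option autoImplicit false

noncomputable section

namespace Summit.Ventures.HodgeRepro.Tier4.Common

open MeasureTheory Measure Topology Set
open scoped ComplexConjugate Pointwise

section Defs

variable {G : Type*} [Group G] [TopologicalSpace G] [IsTopologicalGroup G] [MeasurableSpace G] [BorelSpace G]
  (C : Subgroup G) (ν : Measure C)

/-- **`e ⋆ f`**: the left `(C, χ)`-projection of a function, `(e ⋆ f)(y) = ∫_C χ(κ) f(κ y) dν(κ)`. -/
def lProj (χ f : G → ℂ) (y : G) : ℂ := ∫ κ : C, χ κ * f (κ * y) ∂ν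

/-- **`f ⋆ e`**: the right `(C, χ)`-projection of a function, `(f ⋆ e)(y) = ∫_C χ(κ) f(y κ) dν(κ)`. -/
def rProj (χ f : G → ℂ) (y : G) : ℂ := ∫ κ : C, χ κ * f (y * κ) ∂ν

/-- **`e ⋆ f ⋆ e`**: the bi-projection. -/
def biProj (χ f : G → ℂ) : G → ℂ := lProj C ν χ (rProj C ν χ f)

omit [TopologicalSpace G] [IsTopologicalGroup G] [BorelSpace G] in
/-- `f ⋆ e` is the `(C, χ̄)`-projector `kProj` with the conjugate character. -/
theorem rProj_eq_kProj (χ f : G → ℂ) : rProj C ν χ f = kProj C ν (fun g => conj (χ g)) f := by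
  funext y
  simp only [rProj, kProj, Complex.conj_conj]

omit [TopologicalSpace G] [IsTopologicalGroup G] [BorelSpace G] in
/-- The conjugate of `e ⋆ f` is `ē ⋆ f̄`. -/
theorem cj_lProj (χ f : G → ℂ) : (fun y => conj (lProj C ν χ f y)) = lProj C ν (fun g => conj (χ g)) (fun g => conj (f g)) := by
  funext y
  simp only [lProj, ← integral_conj, map_mul]

omit [TopologicalSpace G] [IsTopologicalGroup G] [BorelSpace G] in
/-- The conjugate of `f ⋆ e` is `f̄ ⋆ ē`. -/
theorem cj_rProj (χ f : G → ℂ) : (fun y => conj (rProj C ν χ f y)) = rProj C ν (fun g => conj (χ g)) (fun g => conj (f g)) := by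
  funext y
  simp only [rProj, ← integral_conj, map_mul]

omit [TopologicalSpace G] [IsTopologicalGroup G] [BorelSpace G] in
/-- The conjugate of `e ⋆ f ⋆ e` is `ē ⋆ f̄ ⋆ ē`. -/
theorem cj_biProj (χ f : G → ℂ) :
    (fun y => conj (biProj C ν χ f y)) = biProj C ν (fun g => conj (χ g)) (fun g => conj (f g)) := by
  simp only [biProj]
  rw [cj_lProj, cj_rProj]

end Defs

section Equivariance

variable {G : Type*} [Group G] [TopologicalSpace G] [IsTopologicalGroup G] [MeasurableSpace G] [BorelSpace G]
  (C : Subgroup G) (ν : Measure C)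

/-- **`f ⋆ e` is right-`(C, χ̄)`-equivariant**: `(f ⋆ e)(y κ₀) = conj χ(κ₀) · (f ⋆ e)(y)` (`ν` left-invariant). -/
theorem rProj_apply_mul [ν.IsMulLeftInvariant] {χ : G → ℂ} (hχ : ∀ a ∈ C, ∀ b ∈ C, χ (a * b) = χ a * χ b)
    (hu : ∀ a ∈ C, ‖χ a‖ = 1) (f : G → ℂ) (y : G) {κ₀ : G} (hκ₀ : κ₀ ∈ C) :
    rProj C ν χ f (y * κ₀) = conj (χ κ₀) * rProj C ν χ f y := by
  rw [rProj_eq_kProj]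
  exact kProj_apply_mul C ν (fun a ha b hb => by simp only [hχ a ha b hb, map_mul])
    (fun a ha => by rw [Complex.norm_conj, hu a ha]) f y hκ₀

/-- **`e ⋆ f` is left-equivariant**: `(e ⋆ f)(κ₀⁻¹ y) = χ(κ₀) · (e ⋆ f)(y)` (`ν` right-invariant — automatic on a
compact `C`, `CompactUnimodular`). -/
theorem lProj_apply_inv_mul [ν.IsMulRightInvariant] {χ : G → ℂ} (hχ : ∀ a ∈ C, ∀ b ∈ C, χ (a * b) = χ a * χ b)
    (f : G → ℂ) (y : G) {κ₀ : G} (hκ₀ : κ₀ ∈ C) :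
    lProj C ν χ f (κ₀⁻¹ * y) = χ κ₀ * lProj C ν χ f y := by
  let k : C := ⟨κ₀, hκ₀⟩
  let F : C → ℂ := fun κ => χ ((κ * k : C) : G) * f (κ * y)
  have hL : (fun κ : C => χ κ * f (κ * (κ₀⁻¹ * y))) = fun κ : C => F (κ * k⁻¹) := by
    funext κ
    show χ κ * f (κ * (κ₀⁻¹ * y)) = χ ((κ * k⁻¹ * k : C) : G) * f (((κ * k⁻¹ : C) : G) * y)
    rw [inv_mul_cancel_right, Subgroup.coe_mul, Subgroup.coe_inv]
    show χ κ * f (κ * (κ₀⁻¹ * y)) = χ κ * f (κ * κ₀⁻¹ * y)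
    rw [mul_assoc]
  have hR : (fun κ : C => F κ) = fun κ : C => χ κ₀ * (χ κ * f (κ * y)) := by
    funext κ
    show χ ((κ * k : C) : G) * f (κ * y) = χ κ₀ * (χ κ * f (κ * y))
    rw [Subgroup.coe_mul]
    show χ (κ * κ₀) * f (κ * y) = χ κ₀ * (χ κ * f (κ * y))
    rw [hχ κ κ.2 κ₀ hκ₀]
    ring
  calc lProj C ν χ f (κ₀⁻¹ * y) = ∫ κ : C, F (κ * k⁻¹) ∂ν := by rw [lProj, hL]
    _ = ∫ κ : C, F κ ∂ν := integral_mul_right_eq_self F k⁻¹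
    _ = χ κ₀ * lProj C ν χ f y := by rw [hR, integral_const_mul, lProj]

/-- `(e ⋆ f)(κ₀ y) = conj χ(κ₀) · (e ⋆ f)(y)`. -/
theorem lProj_apply_mul [ν.IsMulRightInvariant] {χ : G → ℂ} (hχ : ∀ a ∈ C, ∀ b ∈ C, χ (a * b) = χ a * χ b)
    (hu : ∀ a ∈ C, ‖χ a‖ = 1) (f : G → ℂ) (y : G) {κ₀ : G} (hκ₀ : κ₀ ∈ C) :
    lProj C ν χ f (κ₀ * y) = conj (χ κ₀) * lProj C ν χ f y := by
  have := lProj_apply_inv_mul C ν hχ f y (C.inv_mem hκ₀)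
  rw [inv_inv] at this
  rw [this, chi_inv C hχ hu hκ₀, ← conj_eq_inv_of_norm_one (hu κ₀ hκ₀)]

omit [TopologicalSpace G] [IsTopologicalGroup G] [BorelSpace G] in
/-- `e ⋆ ·` preserves right-`(C, χ̄)`-equivariance (no measure hypothesis). -/
theorem lProj_apply_mul_of_right_equivariant {χ f : G → ℂ}
    (hf : ∀ y, ∀ κ ∈ C, f (y * κ) = conj (χ κ) * f y) (y : G) {κ₀ : G} (hκ₀ : κ₀ ∈ C) :
    lProj C ν χ f (y * κ₀) = conj (χ κ₀) * lProj C ν χ f y := by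
  simp only [lProj]
  rw [← integral_const_mul]
  congr 1
  funext κ
  rw [← mul_assoc, hf (κ * y) κ₀ hκ₀]
  ring

/-- **`e ⋆ f ⋆ e` is right-`(C, χ̄)`-equivariant** — the `hfe` of the projector identity `integral_mul_kProj_eq`. -/
theorem biProj_apply_mul [ν.IsMulLeftInvariant] {χ : G → ℂ} (hχ : ∀ a ∈ C, ∀ b ∈ C, χ (a * b) = χ a * χ b)
    (hu : ∀ a ∈ C, ‖χ a‖ = 1) (f : G → ℂ) (y : G) {κ₀ : G} (hκ₀ : κ₀ ∈ C) :
    biProj C ν χ f (y * κ₀) = conj (χ κ₀) * biProj C ν χ f y :=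
  lProj_apply_mul_of_right_equivariant C ν (fun z _ hκ => rProj_apply_mul C ν hχ hu f z hκ) y hκ₀

/-- **`e ⋆ f ⋆ e` is left-equivariant**: `(e ⋆ f ⋆ e)(κ₀⁻¹ y) = χ(κ₀) · (e ⋆ f ⋆ e)(y)` — the shape of KTypeTransport's
`rightRegular_apply_mul_of_left_equivariant`. -/
theorem biProj_apply_inv_mul [ν.IsMulRightInvariant] {χ : G → ℂ} (hχ : ∀ a ∈ C, ∀ b ∈ C, χ (a * b) = χ a * χ b)
    (f : G → ℂ) (y : G) {κ₀ : G} (hκ₀ : κ₀ ∈ C) :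
    biProj C ν χ f (κ₀⁻¹ * y) = χ κ₀ * biProj C ν χ f y :=
  lProj_apply_inv_mul C ν hχ _ y hκ₀

end Equivariance

section TestFunctions

variable {G : Type*} [Group G] [TopologicalSpace G] [IsTopologicalGroup G] [MeasurableSpace G] [BorelSpace G]
  (C : Subgroup G) (ν : Measure C)

/-- `e ⋆ f` is continuous for continuous `f` (parametric integral over the compact `C`). -/
theorem continuous_lProj [CompactSpace C] [IsFiniteMeasure ν] [LocallyCompactSpace G] [FirstCountableTopology G]
    {χ : G → ℂ} (hχc : Continuous fun κ : C => χ κ) {f : G → ℂ} (hf : Continuous f) :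
    Continuous (lProj C ν χ f) := by
  have h : Continuous (Function.uncurry fun (y : G) (κ : C) => χ κ * f (κ * y)) := by
    apply Continuous.mul
    · exact hχc.comp continuous_snd
    · exact hf.comp ((continuous_subtype_val.comp continuous_snd).mul continuous_fst)
  have := continuous_parametric_integral_of_continuous (μ := ν) h isCompact_univ
  simp only [Measure.restrict_univ] at this
  exact this

/-- `f ⋆ e` is continuous for continuous `f`. -/
theorem continuous_rProj [CompactSpace C] [IsFiniteMeasure ν] [LocallyCompactSpace G] [FirstCountableTopology G]
    {χ : G → ℂ} (hχc : Continuous fun κ : C => χ κ) {f : G → ℂ} (hf : Continuous f) :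
    Continuous (rProj C ν χ f) := by
  have h : Continuous (Function.uncurry fun (y : G) (κ : C) => χ κ * f (y * κ)) := by
    apply Continuous.mul
    · exact hχc.comp continuous_snd
    · exact hf.comp (continuous_fst.mul (continuous_subtype_val.comp continuous_snd))
  have := continuous_parametric_integral_of_continuous (μ := ν) h isCompact_univ
  simp only [Measure.restrict_univ] at this
  exact this

omit [BorelSpace G] in
/-- The support of `e ⋆ f` lies in `C⁻¹ · supp f`, a compact set. -/
theorem hasCompactSupport_lProj [CompactSpace C] {χ f : G → ℂ} (hfc : HasCompactSupport f) :
    HasCompactSupport (lProj C ν χ f) := by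
  have hC : IsCompact (C : Set G) := isCompact_iff_compactSpace.2 inferInstance
  refine HasCompactSupport.intro (hC.inv.mul hfc) fun y hy => ?_
  have hzero : ∀ κ : C, f (κ * y) = 0 := by
    intro κ
    apply image_eq_zero_of_notMem_tsupport
    intro hmem
    apply hy
    refine ⟨(κ : G)⁻¹, ?_, (κ : G) * y, hmem, by group⟩
    rw [Set.mem_inv, inv_inv]
    exact κ.2
  simp only [lProj, hzero, mul_zero, integral_zero]

omit [BorelSpace G] in
/-- The support of `f ⋆ e` lies in `supp f · C⁻¹`, a compact set. -/
theorem hasCompactSupport_rProj [CompactSpace C] {χ f : G → ℂ} (hfc : HasCompactSupport f) :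
    HasCompactSupport (rProj C ν χ f) := by
  have hC : IsCompact (C : Set G) := isCompact_iff_compactSpace.2 inferInstance
  refine HasCompactSupport.intro (hfc.mul hC.inv) fun y hy => ?_
  have hzero : ∀ κ : C, f (y * κ) = 0 := by
    intro κ
    apply image_eq_zero_of_notMem_tsupport
    intro hmem
    apply hy
    refine ⟨y * κ, hmem, (κ : G)⁻¹, ?_, by group⟩
    rw [Set.mem_inv, inv_inv]
    exact κ.2
  simp only [rProj, hzero, mul_zero, integral_zero]

/-- **`e ⋆ f ⋆ e` is a test function** (continuous with compact support) when `f` is. -/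
theorem isTestFn_biProj [CompactSpace C] [IsFiniteMeasure ν] [LocallyCompactSpace G] [FirstCountableTopology G]
    {χ : G → ℂ} (hχc : Continuous fun κ : C => χ κ) {f : G → ℂ} (hf : Continuous f) (hfc : HasCompactSupport f) :
    Continuous (biProj C ν χ f) ∧ HasCompactSupport (biProj C ν χ f) :=
  ⟨continuous_lProj C ν hχc (continuous_rProj C ν hχc hf), hasCompactSupport_lProj C ν (hasCompactSupport_rProj C ν hfc)⟩

end TestFunctions

section Operator

variable {G : Type*} [Group G] [TopologicalSpace G] [IsTopologicalGroup G] [MeasurableSpace G] [BorelSpace G]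
  [SecondCountableTopology G] (C : Subgroup G) (ν : Measure C) (μ : Measure G)

/-- The product integrand of `R(e ⋆ f)` is integrable on `μ.prod ν`: continuous, support inside
`(C⁻¹ · supp f) ×ˢ univ`. -/
theorem integrable_prod_lProj [CompactSpace C] [IsFiniteMeasure ν] [IsFiniteMeasureOnCompacts μ] {χ : G → ℂ}
    (hχc : Continuous fun κ : C => χ κ) {f φ : G → ℂ} (hf : Continuous f) (hfc : HasCompactSupport f)
    (hφ : Continuous φ) (x : G) :
    Integrable (Function.uncurry fun (y : G) (κ : C) => χ κ * f (κ * y) * φ (x * y)) (μ.prod ν) := by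
  have hC : IsCompact (C : Set G) := isCompact_iff_compactSpace.2 inferInstance
  apply Continuous.integrable_of_hasCompactSupport
  · apply Continuous.mul
    · apply Continuous.mul
      · exact hχc.comp continuous_snd
      · exact hf.comp ((continuous_subtype_val.comp continuous_snd).mul continuous_fst)
    · exact hφ.comp (continuous_const.mul continuous_fst)
  · apply HasCompactSupport.intro ((hC.inv.mul hfc).prod isCompact_univ)
    intro p hp
    have hzero : f (p.2 * p.1) = 0 := by
      apply image_eq_zero_of_notMem_tsupport
      intro hmem
      apply hp
      refine ⟨⟨(p.2 : G)⁻¹, ?_, (p.2 : G) * p.1, hmem, by group⟩, mem_univ _⟩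
      rw [Set.mem_inv, inv_inv]
      exact p.2.2
    show χ p.2 * f (p.2 * p.1) * φ (x * p.1) = 0
    rw [hzero, mul_zero, zero_mul]

/-- The product integrand of `R(f ⋆ e)` is integrable on `μ.prod ν`. -/
theorem integrable_prod_rProj [CompactSpace C] [IsFiniteMeasure ν] [IsFiniteMeasureOnCompacts μ] {χ : G → ℂ}
    (hχc : Continuous fun κ : C => χ κ) {f φ : G → ℂ} (hf : Continuous f) (hfc : HasCompactSupport f)
    (hφ : Continuous φ) (x : G) :
    Integrable (Function.uncurry fun (y : G) (κ : C) => χ κ * f (y * κ) * φ (x * y)) (μ.prod ν) := by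
  have hC : IsCompact (C : Set G) := isCompact_iff_compactSpace.2 inferInstance
  apply Continuous.integrable_of_hasCompactSupport
  · apply Continuous.mul
    · apply Continuous.mul
      · exact hχc.comp continuous_snd
      · exact hf.comp (continuous_fst.mul (continuous_subtype_val.comp continuous_snd))
    · exact hφ.comp (continuous_const.mul continuous_fst)
  · apply HasCompactSupport.intro ((hfc.mul hC.inv).prod isCompact_univ)
    intro p hp
    have hzero : f (p.1 * p.2) = 0 := by
      apply image_eq_zero_of_notMem_tsupport
      intro hmem
      apply hp
      refine ⟨⟨p.1 * p.2, hmem, (p.2 : G)⁻¹, ?_, by group⟩, mem_univ _⟩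
      rw [Set.mem_inv, inv_inv]
      exact p.2.2
    show χ p.2 * f (p.1 * p.2) * φ (x * p.1) = 0
    rw [hzero, mul_zero, zero_mul]

/-- **`R(e ⋆ f) = e_{C,χ} ∘ R(f)`**: `∫ (e ⋆ f)(y) φ(x y) dμ = e_{C,χ}(R(f) φ)(x)`. -/
theorem integral_lProj_mul_eq [CompactSpace C] [ν.IsHaarMeasure] [IsProbabilityMeasure ν] [SFinite μ]
    [μ.IsMulLeftInvariant] [IsFiniteMeasureOnCompacts μ] {χ : G → ℂ} (hχc : Continuous fun κ : C => χ κ)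
    (hχ : ∀ a ∈ C, ∀ b ∈ C, χ (a * b) = χ a * χ b) (hu : ∀ a ∈ C, ‖χ a‖ = 1) {f φ : G → ℂ} (hf : Continuous f)
    (hfc : HasCompactSupport f) (hφ : Continuous φ) (x : G) :
    ∫ y, lProj C ν χ f y * φ (x * y) ∂μ = kProj C ν χ (fun z => ∫ y, f y * φ (z * y) ∂μ) x := by
  haveI := isInvInvariant_of_compactSpace ν
  have hint := integrable_prod_lProj C ν μ hχc hf hfc hφ x
  have hinner : ∀ κ : C, ∫ y, χ κ * f (κ * y) * φ (x * y) ∂μ = χ κ * ∫ y, f y * φ (x * (κ : G)⁻¹ * y) ∂μ := by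
    intro κ
    have hsub : ∫ y, f (κ * y) * φ (x * (κ : G)⁻¹ * (κ * y)) ∂μ = ∫ y, f y * φ (x * (κ : G)⁻¹ * y) ∂μ :=
      integral_mul_left_eq_self (fun y => f y * φ (x * (κ : G)⁻¹ * y)) (κ : G)
    rw [← hsub, ← integral_const_mul]
    congr 1
    funext y
    rw [show x * (κ : G)⁻¹ * (κ * y) = x * y by group]
    ring
  calc ∫ y, lProj C ν χ f y * φ (x * y) ∂μ
      = ∫ y, ∫ κ : C, χ κ * f (κ * y) * φ (x * y) ∂ν ∂μ := by
        congr 1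
        funext y
        rw [lProj, ← integral_mul_const]
    _ = ∫ κ : C, ∫ y, χ κ * f (κ * y) * φ (x * y) ∂μ ∂ν := integral_integral_swap hint
    _ = ∫ κ : C, χ κ * ∫ y, f y * φ (x * (κ : G)⁻¹ * y) ∂μ ∂ν := by
        congr 1
        funext κ
        exact hinner κ
    _ = kProj C ν χ (fun z => ∫ y, f y * φ (z * y) ∂μ) x := by
        have h := integral_inv_eq_self (fun κ : C => χ ((κ⁻¹ : C) : G) * ∫ y, f y * φ (x * κ * y) ∂μ) ν
        simp only [inv_inv, Subgroup.coe_inv] at h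
        rw [h, kProj]
        congr 1
        funext κ
        rw [chi_inv C hχ hu κ.2, ← conj_eq_inv_of_norm_one (hu κ κ.2)]

/-- **`R(f ⋆ e) = R(f) ∘ e_{C,χ}`**: `∫ (f ⋆ e)(y) φ(x y) dμ = ∫ f(y) (e_{C,χ} φ)(x y) dμ`. -/
theorem integral_rProj_mul_eq [CompactSpace C] [ν.IsHaarMeasure] [IsProbabilityMeasure ν] [SFinite μ]
    [μ.IsMulRightInvariant] [IsFiniteMeasureOnCompacts μ] {χ : G → ℂ} (hχc : Continuous fun κ : C => χ κ)
    (hχ : ∀ a ∈ C, ∀ b ∈ C, χ (a * b) = χ a * χ b) (hu : ∀ a ∈ C, ‖χ a‖ = 1) {f φ : G → ℂ} (hf : Continuous f)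
    (hfc : HasCompactSupport f) (hφ : Continuous φ) (x : G) :
    ∫ y, rProj C ν χ f y * φ (x * y) ∂μ = ∫ y, f y * kProj C ν χ φ (x * y) ∂μ := by
  haveI := isInvInvariant_of_compactSpace ν
  have hint := integrable_prod_rProj C ν μ hχc hf hfc hφ x
  have hint2 : Integrable (Function.uncurry fun (y : G) (κ : C) => f y * (χ κ * φ (x * y * (κ : G)⁻¹)))
      (μ.prod ν) := by
    apply Continuous.integrable_of_hasCompactSupport
    · apply Continuous.mul (hf.comp continuous_fst)
      apply Continuous.mul (hχc.comp continuous_snd)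
      exact hφ.comp ((continuous_const.mul continuous_fst).mul ((continuous_subtype_val.comp continuous_snd).inv))
    · apply HasCompactSupport.intro (hfc.prod isCompact_univ)
      intro p hp
      have : p.1 ∉ tsupport f := fun h => hp ⟨h, mem_univ _⟩
      show f p.1 * (χ p.2 * φ (x * p.1 * (p.2 : G)⁻¹)) = 0
      rw [image_eq_zero_of_notMem_tsupport this, zero_mul]
  have hinner : ∀ κ : C, ∫ y, χ κ * f (y * κ) * φ (x * y) ∂μ = ∫ y, f y * (χ κ * φ (x * y * (κ : G)⁻¹)) ∂μ := by
    intro κ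
    have hsub : ∫ y, f (y * κ) * (χ κ * φ (x * (y * κ) * (κ : G)⁻¹)) ∂μ
        = ∫ y, f y * (χ κ * φ (x * y * (κ : G)⁻¹)) ∂μ :=
      integral_mul_right_eq_self (fun y => f y * (χ κ * φ (x * y * (κ : G)⁻¹))) (κ : G)
    rw [← hsub]
    congr 1
    funext y
    rw [show x * (y * κ) * (κ : G)⁻¹ = x * y by group]
    ring
  calc ∫ y, rProj C ν χ f y * φ (x * y) ∂μ
      = ∫ y, ∫ κ : C, χ κ * f (y * κ) * φ (x * y) ∂ν ∂μ := by
        congr 1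
        funext y
        rw [rProj, ← integral_mul_const]
    _ = ∫ κ : C, ∫ y, χ κ * f (y * κ) * φ (x * y) ∂μ ∂ν := integral_integral_swap hint
    _ = ∫ κ : C, ∫ y, f y * (χ κ * φ (x * y * (κ : G)⁻¹)) ∂μ ∂ν := by
        congr 1
        funext κ
        exact hinner κ
    _ = ∫ y, ∫ κ : C, f y * (χ κ * φ (x * y * (κ : G)⁻¹)) ∂ν ∂μ := (integral_integral_swap hint2).symm
    _ = ∫ y, f y * kProj C ν χ φ (x * y) ∂μ := by
        congr 1
        funext y
        rw [integral_const_mul]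
        congr 1
        have h := integral_inv_eq_self (fun κ : C => χ ((κ⁻¹ : C) : G) * φ (x * y * κ)) ν
        simp only [inv_inv, Subgroup.coe_inv] at h
        rw [h, kProj]
        congr 1
        funext κ
        rw [chi_inv C hχ hu κ.2, ← conj_eq_inv_of_norm_one (hu κ κ.2)]

/-- **`R(e ⋆ f ⋆ e) = e_{C,χ} ∘ R(f) ∘ e_{C,χ}`**: `∫ (e ⋆ f ⋆ e)(y) φ(x y) dμ = e_{C,χ}(R(f)(e_{C,χ} φ))(x)`
(`μ` bi-invariant). -/
theorem integral_biProj_mul_eq [CompactSpace C] [ν.IsHaarMeasure] [IsProbabilityMeasure ν] [SFinite μ]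
    [μ.IsMulLeftInvariant] [μ.IsMulRightInvariant] [IsFiniteMeasureOnCompacts μ] [LocallyCompactSpace G]
    [FirstCountableTopology G] {χ : G → ℂ} (hχc : Continuous fun κ : C => χ κ)
    (hχ : ∀ a ∈ C, ∀ b ∈ C, χ (a * b) = χ a * χ b) (hu : ∀ a ∈ C, ‖χ a‖ = 1) {f φ : G → ℂ} (hf : Continuous f)
    (hfc : HasCompactSupport f) (hφ : Continuous φ) (x : G) :
    ∫ y, biProj C ν χ f y * φ (x * y) ∂μ =
      kProj C ν χ (fun z => ∫ y, f y * kProj C ν χ φ (z * y) ∂μ) x := by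
  rw [biProj, integral_lProj_mul_eq C ν μ hχc hχ hu (continuous_rProj C ν hχc hf) (hasCompactSupport_rProj C ν hfc)
    hφ x]
  congr 1
  funext z
  exact integral_rProj_mul_eq C ν μ hχc hχ hu hf hfc hφ z

end Operator

end Summit.Ventures.HodgeRepro.Tier4.Common

end
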